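import Mathlib
import HarnessLib
import Literature.MathematicalPhysics.StatisticalMechanics.InitialActivityJointSecondDiffBundled

/-!
# The joint second differences of `y₀^{𝒦}(h) = K̂_0(𝒦, h)` in the BILINEAR form `m₀₀(u + ‖y‖)(v + ‖z‖)`
# (hypothesis `hμ12` of `RGFlow.secondDiff_initial_le_of_isTunedQ`, literally)

Continuation of `InitialActivityJointSecondDiffBundled.lean`: the five-term bound of
`activityNormLE_initAct_jointSecondDiff` is dominated by `m₀₀·(u + ‖y‖)·(v + ‖z‖)` with the explicit,
volume-independent constant
`m₀₀ = (3/2)(16e^{3/8})² + 128e^{1/4} + 12·16e^{3/8}·e^{𝔥_0}A + 6(e^{𝔥_0}e^{1/4}A)²`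
(using `tA ≤ ½` from the smallness), which is the shape `m₀₀ * (δ₁ + ‖y‖) * (δ₂ + ‖z‖)` consumed by the
second-order fixed-point theorem ([ABKM19] Lemma 12.2 with `j₁ + j₂ = 2`).

* **`activityNormLE_initAct_jointSecondDiff_bilinear`**.

Everything is proved; no named fact.

## References
* S. Adams, S. Buchholz, R. Kotecký, S. Müller, arXiv:1910.13564, Lemma 12.2 (12.9), Lemma 12.6
  [AdamsBuchholzKoteckyMuller2019].
-/

noncomputable section

namespace Literature.MathematicalPhysics.StatisticalMechanics.GradientRG

open scoped BigOperators Classical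
open Finset Matrix
open Literature.MathematicalPhysics.QuantumFieldTheory

variable {d M : ℕ} [NeZero M]

section Bundled

variable {L N Mord R n p r₀ : ℕ} {θbar lam μ δ₁ δ₀ A𝒫 h A : ℝ} {𝒞 : ℕ → (Fin d → ZMod M) → ℝ}

/-- **Hypothesis `hμ12` of `RGFlow.secondDiff_initial_le_of_isTunedQ` for the torus data, bilinear form**:
`‖y₀^{𝒦+U+V}(x+y+z) − y₀^{𝒦+U}(x+y) − y₀^{𝒦+V}(x+z) + y₀^{𝒦}(x)‖_0^{(A)} ≤ m₀₀·(u + ‖y‖)·(v + ‖z‖)` with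
`m₀₀ = (3/2)(16e^{3/8})² + 128e^{1/4} + 192e^{3/8}e^{𝔥_0}A + 6(e^{𝔥_0}e^{1/4}A)²`.
[cite: AdamsBuchholzKoteckyMuller2019, Lemma 12.2 (12.9) / Lemma 12.6] -/
theorem activityNormLE_initAct_jointSecondDiff_bilinear
    [∀ j : ℕ, Fact (0 < fieldWt h (L : ℝ) d j)] [∀ j : ℕ, Fact (0 < (L : ℝ) ^ j)] [∀ j : ℕ, Fact (0 < L ^ (d * j))]
    (hd : 2 ≤ d) (hLodd : Odd L) (hM : M = L ^ N)
    (hp : d / 2 + 1 ≤ p) (hMord : d / 2 + 1 ≤ Mord)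
    (hB : AbkmWeightBounds L N Mord R n θbar lam μ δ₁ δ₀ A𝒫 𝒞
      (abkmWeightData L N Mord R θbar (schedDelta δ₀ δ₁ N) 𝒞))
    (hδ₀ : 0 < δ₀) (hδ₁ : 0 < δ₁) (hh : 0 < h) (hh0 : hZeroSq d R δ₀ δ₁ ≤ h ^ 2) (hA : 0 < A)
    {𝒦 U V : (Fin d → ℝ) → ℂ} {ρ u v : ℝ}
    (h𝒦 : ContDiff ℝ r₀ 𝒦) (hU : ContDiff ℝ r₀ U) (hV : ContDiff ℝ r₀ V)
    (h𝒦b : ∀ k, k ≤ r₀ → ∀ z : Fin d → ℝ, ‖iteratedFDeriv ℝ k 𝒦 z‖ ≤ ρ * Real.exp ((∑ i, z i ^ 2) / 4))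
    (h𝒦Ub : ∀ k, k ≤ r₀ → ∀ z : Fin d → ℝ,
      ‖iteratedFDeriv ℝ k (fun z => 𝒦 z + U z) z‖ ≤ ρ * Real.exp ((∑ i, z i ^ 2) / 4))
    (h𝒦Vb : ∀ k, k ≤ r₀ → ∀ z : Fin d → ℝ,
      ‖iteratedFDeriv ℝ k (fun z => 𝒦 z + V z) z‖ ≤ ρ * Real.exp ((∑ i, z i ^ 2) / 4))
    (h𝒦UVb : ∀ k, k ≤ r₀ → ∀ z : Fin d → ℝ,
      ‖iteratedFDeriv ℝ k (fun z => 𝒦 z + U z + V z) z‖ ≤ ρ * Real.exp ((∑ i, z i ^ 2) / 4))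
    (hUb : ∀ k, k ≤ r₀ → ∀ z : Fin d → ℝ, ‖iteratedFDeriv ℝ k U z‖ ≤ u * Real.exp ((∑ i, z i ^ 2) / 4))
    (hVb : ∀ k, k ≤ r₀ → ∀ z : Fin d → ℝ, ‖iteratedFDeriv ℝ k V z‖ ≤ v * Real.exp ((∑ i, z i ^ 2) / 4))
    (hsmall1 : Real.exp (1 / 4) * (ρ * Real.exp (fieldWt h (L : ℝ) d 0 / (L : ℝ) ^ 0)) * A ≤ 1)
    (x y z : HamSpace ℂ d (fieldWt h (L : ℝ) d 0) ((L : ℝ) ^ 0) (L ^ (d * 0)))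
    (hx : ‖x‖ ≤ 1 / 64) (hxy : ‖x + y‖ ≤ 1 / 64) (hxz : ‖x + z‖ ≤ 1 / 64) (hxyz : ‖x + y + z‖ ≤ 1 / 64)
    (hsmall : (Real.exp (1 / 4) + 16 * Real.exp (3 / 8) * ‖y‖ + 16 * Real.exp (3 / 8) * ‖z‖
        + 256 * Real.exp (1 / 4) * ‖y‖ * ‖z‖)
        * ((ρ + u + v) * Real.exp (fieldWt h (L : ℝ) d 0 / (L : ℝ) ^ 0)) * A ≤ 1 / 2) :
    activityNormLE (abkmNormParams L N Mord R p r₀ h θbar A (schedDelta δ₀ δ₁ N) 𝒞) 0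
      (initAct (N := N) (Mord := Mord) (R := R) (p := p) (r₀ := r₀) (θbar := θbar) (A := A) (δ₀ := δ₀)
          (δ₁ := δ₁) (𝒞 := 𝒞) (fun w => 𝒦 w + U w + V w) (x + y + z) -
        initAct (N := N) (Mord := Mord) (R := R) (p := p) (r₀ := r₀) (θbar := θbar) (A := A) (δ₀ := δ₀)
          (δ₁ := δ₁) (𝒞 := 𝒞) (fun w => 𝒦 w + U w) (x + y) -
        initAct (N := N) (Mord := Mord) (R := R) (p := p) (r₀ := r₀) (θbar := θbar) (A := A) (δ₀ := δ₀)
          (δ₁ := δ₁) (𝒞 := 𝒞) (fun w => 𝒦 w + V w) (x + z) +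
        initAct (N := N) (Mord := Mord) (R := R) (p := p) (r₀ := r₀) (θbar := θbar) (A := A) (δ₀ := δ₀)
          (δ₁ := δ₁) (𝒞 := 𝒞) 𝒦 x)
      (((3 / 2 : ℝ) * (16 * Real.exp (3 / 8)) ^ 2 + 128 * Real.exp (1 / 4)
          + 192 * Real.exp (3 / 8) * (Real.exp (fieldWt h (L : ℝ) d 0 / (L : ℝ) ^ 0) * A)
          + 6 * (Real.exp (fieldWt h (L : ℝ) d 0 / (L : ℝ) ^ 0) * Real.exp (1 / 4) * A) ^ 2)
        * (u + ‖y‖) * (v + ‖z‖)) := by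
  have h0 := activityNormLE_initAct_jointSecondDiff (p := p) (r₀ := r₀) hd hLodd hM hp hMord hB hδ₀ hδ₁ hh hh0 hA
    h𝒦 hU hV h𝒦b h𝒦Ub h𝒦Vb h𝒦UVb hUb hVb hsmall1 x y z hx hxy hxz hxyz hsmall
  have hPA : 0 < (abkmNormParams L N Mord R p r₀ h θbar A (schedDelta δ₀ δ₁ N) 𝒞).A := by
    rw [abkmNormParams_A]; exact hA
  refine (isSubaddNormBound_activityNormLE _ hPA).mono 0 _ _ _ h0 ?_
  -- the real inequality
  set e' := Real.exp (fieldWt h (L : ℝ) d 0 / (L : ℝ) ^ 0) with he'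
  set a := Real.exp (1 / 4) with ha
  set c₁ := 16 * Real.exp (3 / 8) with hc₁
  set ny := ‖y‖ with hny
  set nz := ‖z‖ with hnz
  set T := (ρ + u + v) * e' * A with hT
  have nonneg_of : ∀ {F : (Fin d → ℝ) → ℂ} {s : ℝ},
      (∀ k, k ≤ r₀ → ∀ z : Fin d → ℝ, ‖iteratedFDeriv ℝ k F z‖ ≤ s * Real.exp ((∑ i, z i ^ 2) / 4)) → 0 ≤ s :=
    fun hb => by
      have h1 := (norm_nonneg _).trans (hb 0 (Nat.zero_le _) 0)
      exact (mul_nonneg_iff_of_pos_right (Real.exp_pos _)).1 h1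
  have hρ : 0 ≤ ρ := nonneg_of h𝒦b
  have hu : 0 ≤ u := nonneg_of hUb
  have hv : 0 ≤ v := nonneg_of hVb
  have he'0 : 0 < e' := Real.exp_pos _
  have ha1 : 1 ≤ a := by rw [ha]; exact Real.one_le_exp (by norm_num)
  have ha0 : 0 < a := by linarith
  have hc₁0 : 0 < c₁ := by rw [hc₁]; exact mul_pos (by norm_num) (Real.exp_pos _)
  have hny0 : 0 ≤ ny := norm_nonneg _
  have hnz0 : 0 ≤ nz := norm_nonneg _
  have hT0 : 0 ≤ T := by rw [hT]; exact mul_nonneg (mul_nonneg (by linarith) he'0.le) hA.le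
  -- `T ≤ ½` from the smallness (`a ≥ 1`, the other summands nonnegative)
  have hTle : T ≤ 1 / 2 := by
    have h1 : (a + c₁ * ny + c₁ * nz + 256 * a * ny * nz) * T ≤ 1 / 2 := by
      have e : (a + c₁ * ny + c₁ * nz + 256 * a * ny * nz) * T
          = (a + c₁ * ny + c₁ * nz + 256 * a * ny * nz) * ((ρ + u + v) * e') * A := by rw [hT]; ring
      rw [e]; exact hsmall
    have h2 : 1 ≤ a + c₁ * ny + c₁ * nz + 256 * a * ny * nz := by
      have : 0 ≤ c₁ * ny + c₁ * nz + 256 * a * ny * nz :=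
        add_nonneg (add_nonneg (mul_nonneg hc₁0.le hny0) (mul_nonneg hc₁0.le hnz0))
          (mul_nonneg (mul_nonneg (mul_nonneg (by norm_num) ha0.le) hny0) hnz0)
      linarith
    calc T = 1 * T := (one_mul T).symm
      _ ≤ (a + c₁ * ny + c₁ * nz + 256 * a * ny * nz) * T := mul_le_mul_of_nonneg_right h2 hT0
      _ ≤ 1 / 2 := h1
  have heA : 0 ≤ e' * A := mul_nonneg he'0.le hA.le
  -- term by term
  have hcnn : 0 ≤ c₁ ^ 2 * (ny * nz) := mul_nonneg (pow_nonneg hc₁0.le 2) (mul_nonneg hny0 hnz0)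
  have hann : 0 ≤ a * (ny * nz) := mul_nonneg ha0.le (mul_nonneg hny0 hnz0)
  have t1 : 6 * (c₁ * ny) * (c₁ * nz) * T ^ 2 ≤ (3 / 2 : ℝ) * c₁ ^ 2 * (ny * nz) := by
    have hT2 : T ^ 2 ≤ (1 / 2) ^ 2 := pow_le_pow_left₀ hT0 hTle 2
    calc 6 * (c₁ * ny) * (c₁ * nz) * T ^ 2 = (6 * (c₁ ^ 2 * (ny * nz))) * T ^ 2 := by ring
      _ ≤ (6 * (c₁ ^ 2 * (ny * nz))) * (1 / 2) ^ 2 := mul_le_mul_of_nonneg_left hT2 (by linarith)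
      _ = (3 / 2 : ℝ) * c₁ ^ 2 * (ny * nz) := by ring
  have t2 : 256 * a * ny * nz * T ≤ 128 * a * (ny * nz) := by
    calc 256 * a * ny * nz * T = (256 * (a * (ny * nz))) * T := by ring
      _ ≤ (256 * (a * (ny * nz))) * (1 / 2) := mul_le_mul_of_nonneg_left hTle (by linarith)
      _ = 128 * a * (ny * nz) := by ring
  have t3 : 6 * (c₁ * ny) * (v * e' * A) = 6 * c₁ * (e' * A) * (ny * v) := by ring
  have t4 : 6 * (c₁ * nz) * (u * e' * A) = 6 * c₁ * (e' * A) * (u * nz) := by ring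
  have t5 : 6 * u * v * (e' * a * A) ^ 2 = 6 * (e' * a * A) ^ 2 * (u * v) := by ring
  -- each product of sizes is dominated by `(u + ny)(v + nz)`
  have hprod : (u + ny) * (v + nz) = u * v + u * nz + ny * v + ny * nz := by ring
  have puv := mul_nonneg hu hv
  have punz := mul_nonneg hu hnz0
  have pnyv := mul_nonneg hny0 hv
  have pnynz := mul_nonneg hny0 hnz0
  have d1 : ny * nz ≤ (u + ny) * (v + nz) := by rw [hprod]; linarith
  have d2 : ny * v ≤ (u + ny) * (v + nz) := by rw [hprod]; linarith
  have d3 : u * nz ≤ (u + ny) * (v + nz) := by rw [hprod]; linarith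
  have d4 : u * v ≤ (u + ny) * (v + nz) := by rw [hprod]; linarith
  have k1 : 0 ≤ (3 / 2 : ℝ) * c₁ ^ 2 := mul_nonneg (by norm_num) (pow_nonneg hc₁0.le 2)
  have k2 : 0 ≤ 128 * a := mul_nonneg (by norm_num) ha0.le
  have k3 : 0 ≤ 6 * c₁ * (e' * A) := mul_nonneg (mul_nonneg (by norm_num) hc₁0.le) heA
  have k5 : 0 ≤ 6 * (e' * a * A) ^ 2 := mul_nonneg (by norm_num) (pow_nonneg (mul_nonneg (mul_nonneg he'0.le ha0.le) hA.le) 2)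
  have e256 : 256 * Real.exp (1 / 4) * ny * nz = 256 * a * ny * nz := by rw [ha]
  rw [e256, t3, t4, t5]
  calc 6 * (c₁ * ny) * (c₁ * nz) * T ^ 2 + 256 * a * ny * nz * T + 6 * c₁ * (e' * A) * (ny * v)
        + 6 * c₁ * (e' * A) * (u * nz) + 6 * (e' * a * A) ^ 2 * (u * v)
      ≤ (3 / 2 : ℝ) * c₁ ^ 2 * (ny * nz) + 128 * a * (ny * nz) + 6 * c₁ * (e' * A) * (ny * v)
        + 6 * c₁ * (e' * A) * (u * nz) + 6 * (e' * a * A) ^ 2 * (u * v) := by linarith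
    _ ≤ (3 / 2 : ℝ) * c₁ ^ 2 * ((u + ny) * (v + nz)) + 128 * a * ((u + ny) * (v + nz))
        + 6 * c₁ * (e' * A) * ((u + ny) * (v + nz)) + 6 * c₁ * (e' * A) * ((u + ny) * (v + nz))
        + 6 * (e' * a * A) ^ 2 * ((u + ny) * (v + nz)) :=
        add_le_add (add_le_add (add_le_add (add_le_add (mul_le_mul_of_nonneg_left d1 k1)
          (mul_le_mul_of_nonneg_left d1 k2)) (mul_le_mul_of_nonneg_left d2 k3)) (mul_le_mul_of_nonneg_left d3 k3))
          (mul_le_mul_of_nonneg_left d4 k5)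
    _ = (((3 / 2 : ℝ) * c₁ ^ 2 + 128 * a + 192 * Real.exp (3 / 8) * (e' * A) + 6 * (e' * a * A) ^ 2)
        * (u + ny) * (v + nz)) := by rw [hc₁]; ring

end Bundled

end Literature.MathematicalPhysics.StatisticalMechanics.GradientRG

end
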